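import Summits.ResolutionOfSingularities.ResolutionOfSingularities.Theses.RadicialJung
import Summits.ResolutionOfSingularities.ResolutionOfSingularities.Theorems.PAlterationPicoverTowerTransport

/-!
# Route `RadicialJung`, support `CleanResolves`: reduction to the base `V` itself

Route `ResolutionOfSingularities/RadicialJung`, support item `CleanResolves`
(stmt-ResolutionOfSingularities-16286). The item says: for a regular integral separated finite-type
`W/k` (`char k = p`), a purely inseparable `L/K(W)` of degree `p` and a proper birational regular model
`π : V → W` which is pointwise log-clean for `L`, the normalisation `W^L` of `W` in `L` has a resolution.

This file proves the TRANSPORT half of the plan ("then transport along `V^L → W^L` (proper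
birational)"): `CleanResolves` follows from its own special case `π = 𝟙` — it suffices to resolve the
normalisation `V^L` of the clean model `V` itself in `L` (made a `K(V)`-algebra through the
isomorphism `π^♯ : K(W) ≅ K(V)` of function fields of the birational `π`). The comparison
`V^L → W^L` is proper and birational by the proved tower-transport theorem
`Theorems.Picover.TowerTransport.hasResolution_normalizationIn_of_isProper` of route `pAlteration`
(universal property of the relative normalisation, Stacks 035I/02UP, normality of `W^L`), fed with the
proved function-field identification `K(W^L) ≅ L`
(`Theorems.Picover.FunctionFieldNormalizationIn.stub_functionField_normalizationIn`).

What is NOT here: the local statement `hasResolution_normalizationIn_of_clean` itself (log-regularity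
of `V^L` at toroidal-type points, regularity at regular-type points, Kato 1994 (10.4) and the gluing of
the charts) — the open content of the item.
-/

noncomputable section

set_option linter.dupNamespace false -- mandated namespace of this single-conjunct summit

open CategoryTheory CategoryTheory.Limits AlgebraicGeometry TopologicalSpace
open Literature.AlgebraicGeometry.Resolution Literature.AlgebraicGeometry.Motives
open Summit.ResolutionOfSingularities.ResolutionOfSingularities.Theorems.Picover

namespace Summit.ResolutionOfSingularities.ResolutionOfSingularities.Theorems.RadicialJung.CleanResolves

/-! ## Resolvability of the normalisation descends along proper birational models -/

/-- **Resolvability of `V^L` descends to `W^L` along a proper birational `π : V → W`.** Let `W` be an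
integral scheme locally of finite type over a field `k`, `L/K(W)` a finite extension, `V` integral,
`π : V → W` proper, dominant and birational, and let `L` carry a `K(V)`-algebra structure whose
restriction along `π^♯ : K(W) → K(V)` is the given one. If the normalisation `V^L` of `V` in `L` has a
resolution, so has `W^L`: the fibre of `π` over the generic point is the generic point (`π` is an
isomorphism over a dense open), so the proved tower-transport theorem
`TowerTransport.hasResolution_normalizationIn_of_isProper` applies, with the function-field
identification `K(W^L) ≅ L` supplied by
`FunctionFieldNormalizationIn.stub_functionField_normalizationIn` (both proved in tree, route
`pAlteration`). [folklore] -/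
theorem hasResolution_normalizationIn_of_isBirational {k : Type} [Field k] (W : Scheme.{0})
    [IsIntegral W] (f : W ⟶ Spec (.of k)) [LocallyOfFiniteType f] (L : Type) [Field L]
    [Algebra W.functionField L] [FiniteDimensional W.functionField L] (V : Scheme.{0})
    [IsIntegral V] [Algebra V.functionField L] [FiniteDimensional V.functionField L] (π : V ⟶ W)
    [IsProper π] [IsDominant π] (hπ : IsBirational π)
    (hcompat : (algebraMap V.functionField L).comp (RatFn.functionFieldMap π) =
      algebraMap W.functionField L)
    (hres : Scheme.HasResolution (normalizationIn V L)) :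
    Scheme.HasResolution (normalizationIn W L) := by
  -- the fibre of `π` over the generic point of `W` is the generic point of `V`
  have hfib : ∀ v : V, π v = genericPoint W → v = genericPoint V := by
    intro v hv
    obtain ⟨U, hU, -, hUiso⟩ := hπ
    haveI := hUiso
    have hηU : genericPoint W ∈ U :=
      ((genericPoint_spec W).mem_open_set_iff U.isOpen).mpr (by simpa using hU.nonempty)
    exact TowerTransport.subsingleton_preimage_of_isIso_morphismRestrict π U hηU hv
      (RatFn.genericPoint_eq_of_isDominant π)
  exact TowerTransport.hasResolution_normalizationIn_of_isProper
    FunctionFieldNormalizationIn.stub_functionField_normalizationIn W f L V π hcompat hfib hres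

/-! ## The reduction of `CleanResolves` to the clean model itself -/

/-- **`CleanResolves` reduces to the clean model itself.** Suppose that for every prime `p`, every
field `k` of characteristic `p`, every regular integral separated `V` of finite type over `k` and every
purely inseparable degree-`p` extension `L/K(V)` which is POINTWISE LOG-CLEAN on `V` itself — at every
`v ∈ V` some `y ∈ L ∖ K(V)` has `y^p = g ∈ K(V)` with `g = ∏_{i<m} t_i^{a_i}` for a minimal generating
system `(t_1..t_d)` of `𝔪_v`, `d = dim 𝒪_{V,v}`, `1 ≤ m`, `p ∤ a_i` (toroidal type), or `g = u₀` a unit of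
`𝒪_{V,v}` with `(∀ c, u₀ - c^p ∉ 𝔪_v) ∨ (∃ c, u₀ - c^p ∈ 𝔪_v ∖ 𝔪_v²)` (regular type) — the
normalisation `V^L = normalizationIn V L` has a resolution. Then `CleanResolves` holds: given the data
`(W, L, V, π)` of the item, `π^♯ : K(W) → K(V)` is bijective (`π` is birational), `L` becomes a
`K(V)`-algebra, purely inseparable of degree `p` and pointwise log-clean on `V` (the item's conditions
are stated through `π^♯ g`), so `V^L` has a resolution, which descends to `W^L` along the proper
birational comparison `V^L → W^L` (`TowerTransport.hasResolution_normalizationIn_of_isProper`).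
[folklore] -/
theorem cleanResolves_of_self
    (h : ∀ p : ℕ, p.Prime → ∀ (k : Type) [Field k] [CharP k p] (V : Scheme.{0}) [IsIntegral V]
      (f : V ⟶ Spec (.of k)) (L : Type) [Field L] [Algebra V.functionField L],
      IsSeparated f → LocallyOfFiniteType f → QuasiCompact f → Scheme.IsRegular V →
      IsPurelyInseparable V.functionField L → Module.finrank V.functionField L = p →
      (∀ v : V, ∃ (y : L) (g : V.functionField), y ∉ Set.range (algebraMap V.functionField L) ∧
        algebraMap V.functionField L g = y ^ p ∧
        ((∃ (d m : ℕ) (hmd : m ≤ d) (t : Fin d → V.presheaf.stalk v) (a : Fin m → ℕ),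
            Ideal.span (Set.range t) = IsLocalRing.maximalIdeal (V.presheaf.stalk v) ∧
            ringKrullDim (V.presheaf.stalk v) = (d : WithBot ℕ∞) ∧ 0 < m ∧ (∀ i, ¬ p ∣ a i) ∧
            g = ∏ i : Fin m,
              (algebraMap (V.presheaf.stalk v) V.functionField (t (Fin.castLE hmd i))) ^ (a i)) ∨
          (∃ u₀ : V.presheaf.stalk v, IsUnit u₀ ∧
            g = algebraMap (V.presheaf.stalk v) V.functionField u₀ ∧
            ((∀ c : V.presheaf.stalk v,
                u₀ - c ^ p ∉ IsLocalRing.maximalIdeal (V.presheaf.stalk v)) ∨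
              (∃ c : V.presheaf.stalk v,
                u₀ - c ^ p ∈ IsLocalRing.maximalIdeal (V.presheaf.stalk v) ∧
                u₀ - c ^ p ∉ IsLocalRing.maximalIdeal (V.presheaf.stalk v) ^ 2))))) →
      Scheme.HasResolution (normalizationIn V L)) :
    Summit.ResolutionOfSingularities.ResolutionOfSingularities.Theses.RadicialJung.CleanResolves := by
  intro p hp k _ _ W _ f L _ _ hsep hloc hqc _hWreg hPI hdeg V π _ _ hV
  obtain ⟨hπprop, hπbir, hVreg, hclean⟩ := hV
  haveI := hπprop
  -- `π^♯ : K(W) ≅ K(V)`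
  have hbij : Function.Bijective (RatFn.functionFieldMap π) :=
    TowerTransport.bijective_functionFieldMap_of_isIso π hπbir.isIso_stalkMap_genericPoint
  let e : W.functionField ≃+* V.functionField := RingEquiv.ofBijective _ hbij
  have he : ∀ x, e x = RatFn.functionFieldMap π x := fun _ => rfl
  -- `L` as a `K(V)`-algebra
  letI : Algebra V.functionField L :=
    ((algebraMap W.functionField L).comp e.symm.toRingHom).toAlgebra
  have halg : algebraMap V.functionField L =
      (algebraMap W.functionField L).comp e.symm.toRingHom := rfl
  have hcompat : (algebraMap V.functionField L).comp (RatFn.functionFieldMap π) =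
      algebraMap W.functionField L := by
    refine RingHom.ext fun x => ?_
    rw [halg, RingHom.comp_apply, RingHom.comp_apply, ← he]
    exact congrArg (algebraMap W.functionField L) (e.symm_apply_apply x)
  -- degree `p`, purely inseparable, characteristic `p`
  have hdeg' : Module.finrank V.functionField L = p := by
    rw [← hdeg]
    exact Algebra.finrank_eq_of_equiv_equiv e.symm (RingEquiv.refl L) (by ext x; simp [halg])
  haveI : FiniteDimensional W.functionField L :=
    Module.finite_of_finrank_pos (by rw [hdeg]; exact hp.pos)
  haveI : FiniteDimensional V.functionField L :=
    Module.finite_of_finrank_pos (by rw [hdeg']; exact hp.pos)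
  haveI : CharP W.functionField p := TowerTransport.charP_functionField W f
  haveI : CharP V.functionField p := TowerTransport.charP_functionField V (π ≫ f)
  haveI : ExpChar W.functionField p := ExpChar.prime hp
  haveI : ExpChar V.functionField p := ExpChar.prime hp
  haveI : IsPurelyInseparable V.functionField L :=
    TowerTransport.isPurelyInseparable_of_ringEquiv_base (p := p) e.symm halg.symm
  -- pointwise log-cleanliness of `L/K(V)` on `V`
  have hclean' : ∀ v : V, ∃ (y : L) (g : V.functionField),
      y ∉ Set.range (algebraMap V.functionField L) ∧ algebraMap V.functionField L g = y ^ p ∧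
      ((∃ (d m : ℕ) (hmd : m ≤ d) (t : Fin d → V.presheaf.stalk v) (a : Fin m → ℕ),
          Ideal.span (Set.range t) = IsLocalRing.maximalIdeal (V.presheaf.stalk v) ∧
          ringKrullDim (V.presheaf.stalk v) = (d : WithBot ℕ∞) ∧ 0 < m ∧ (∀ i, ¬ p ∣ a i) ∧
          g = ∏ i : Fin m,
            (algebraMap (V.presheaf.stalk v) V.functionField (t (Fin.castLE hmd i))) ^ (a i)) ∨
        (∃ u₀ : V.presheaf.stalk v, IsUnit u₀ ∧
          g = algebraMap (V.presheaf.stalk v) V.functionField u₀ ∧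
          ((∀ c : V.presheaf.stalk v,
              u₀ - c ^ p ∉ IsLocalRing.maximalIdeal (V.presheaf.stalk v)) ∨
            (∃ c : V.presheaf.stalk v,
              u₀ - c ^ p ∈ IsLocalRing.maximalIdeal (V.presheaf.stalk v) ∧
              u₀ - c ^ p ∉ IsLocalRing.maximalIdeal (V.presheaf.stalk v) ^ 2)))) := by
    intro v
    obtain ⟨y, g, hy, hg, hcases⟩ := hclean v
    refine ⟨y, RatFn.functionFieldMap π g, ?_, ?_, hcases⟩
    · rintro ⟨x, hx⟩
      exact hy ⟨e.symm x, by rw [← hx, halg]; rfl⟩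
    · rw [← hg, halg, RingHom.comp_apply, ← he]
      exact congrArg (algebraMap W.functionField L) (e.symm_apply_apply g)
  -- the clean model resolves its own normalisation
  have hres : Scheme.HasResolution (normalizationIn V L) :=
    h p hp k V (π ≫ f) L inferInstance inferInstance inferInstance hVreg inferInstance hdeg' hclean'
  -- transport along the proper birational comparison `V^L → W^L`
  exact hasResolution_normalizationIn_of_isBirational W f L V π hπbir hcompat hres

end Summit.ResolutionOfSingularities.ResolutionOfSingularities.Theorems.RadicialJung.CleanResolves

end
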